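import Summits.QuantumFields.BalabanUV.T4Continuum.Support.NE7K1LinWalkParametrix
import Summits.QuantumFields.BalabanUV.T4Continuum.Support.NE7K1LinSchurLineU1Sharp
import Summits.QuantumFields.BalabanUV.T4Continuum.Support.NE7K1LinHomTrial
import Summits.QuantumFields.BalabanUV.T4Continuum.Support.NE7K1LinTwoRunMonotone
import Summits.QuantumFields.BalabanUV.T4Continuum.Support.NE7K1LinRunBScales

/-!
# NE7K1LinWalkLine — row NE7 (node U5), candidate route HOM, path H1L, cell K1-lin(s): THE ψ-RESCALED EXTENDED TWO-CUTOFF OPERATOR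
# `𝒫♮(s)` (μ = 1∕n) — the object on which B4 §2's random walk runs for the WHOLE LINE at U = 1: its coarse inverse block IS
# `(twoCutoffLine s)⁻¹`, it is coercive with a constant FREE OF THE MESH AND OF `s`, and its cut-off commutator FACTORS through the
# fine lattice (`[diag(λ∘site), 𝒫♮(s)] = (1−s)·[diag λ, P_A] ⊕ 0 + L^{−(d+1)}·(T_μS_s)ᵀ[diag(λ∘blk), P_fine](T_μS_s)`)

Lineage `b2b-balaban-t4-ne7-p2` (CRUX PROVER NE7 #2), generation 68; series (RW) file 9 — the first file of the TWO-CUTOFF instance,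
over `NE7K1LinSchurLineU1Sharp` (g64: `scaleR`, `coordTμ`, `runBμ`, `lineOpR_runBμ` — the LINE is invariant under ψ-rescaling),
`NE7K1LinHomTrial.schurB_form_le_trial_fluct` + `NE7K1LinTwoRunJensen.runA_form_le_schurB_sharp` (Jensen: `P_A ⪯ H_B` on every trial),
`NE7K1LinTwoRunMonotone.twoCutoffLine_coercive_sharp`, `NE7K1LinRunBScales` (block Poincaré bookkeeping).  WHY (located obstruction of
this gen, card §3m): the √s-extended operator `𝒫(s)` of `NE7K1LinSchurLineForm` is finite-range in BLOCK coordinates, where a cut-off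
is block-constant on the fluctuation coordinates; in the plain `ℓ²` currency its cut-off commutator is mesh-DEPENDENT (`~ nL²∕M`).  With
the fluctuation coordinates rescaled by `μ = 1∕n` (g64's device with another `μ`) every block of the commutator is `O(1∕M)` uniformly in
the mesh, while the LINE — hence `G(s)` — is unchanged.  THIS FILE supplies the object and its three structural facts; the commutator
BOUND ((H-comm) for `𝒫♮(s)`) and the assembly with files 1–3 are the successor's.

* `extLine s` = `extOpR P_A (H♮₁₁) (H♮₁₂) (H♮₂₁) (H♮₂₂) s` with `H♮ = runBμ (1∕n) = S_{1∕n}·H_B·S_{1∕n}`; **`extLine_inv_inl_inl`**: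
  `(extLine s)⁻¹(inl x, inl y) = (twoCutoffLine s)⁻¹(x,y)` for `s ∈ [0,1]` (`lineOpR_runBμ` + `inv_extOpR_inl_inl`).
* `runB_form_ge_runA` (`⟨V,P_AV⟩ ≤ ⟨(V,ψ),H_B(V,ψ)⟩` for EVERY `ψ`), **`runB_form_ge_fluct`** (`(2n²∕L^{d+1})‖ψ‖² ≤ ⟨(V,ψ),H_B(V,ψ)⟩` for
  EVERY `V` — the fluctuation floor of `NE7K1LinRunBScales.runB_fluct_floor` off the subspace `V = 0`: within-block energy ignores `V`);
  `extLine_form`; **`extLine_coercive`**: `min(min(2,a)∕2, L^{−(d+1)})·‖w‖² ≤ ⟨w, extLine s w⟩` for all `s ∈ [0,1]` — NO `n`.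
* `coordTμ_mul_diagonal` (`T_μ·diag(λ∘site) = diag(λ∘blk)·T_μ`, from `coordTμ_compat`), `extLine_eq` (the operator as
  `(1−s)·P_A ⊕ 0 + L^{−(d+1)}(T_μS_s)ᵀP_f(T_μS_s)`, `S_s = diag(√s ⊕ 1)`), **`comm_extLine`** (the factorisation displayed in the title).

HONEST FRAMING: [folklore] finite linear algebra at the Gaussian `A = 0` level; no (H-comm) bound for `𝒫♮` yet, no walk expansion of the
line yet (successor); nothing of Bałaban's asserted; no `sorry`.  Census only; NO letter ∕ tag ∕ size of NE7 moves; NE7 NOT PRINTED ∕ NOT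
PROVED; spine 0∕9; FIXED FINITE T⁴, rung (B)+1; NOT infinite volume, NOT mass gap, NOT Clay.  HONEST DEPENDENCY: continuum YM on T⁴ ⇐
BetaPertH ∧ nine spine estimates (0/9 proved); BetaPertH ⇐ (D1) ∧ (D4) ∧ CAP+tail; G-an2-4 gates asym, D1 and NE2/3/4.
-/

noncomputable section

open Finset Matrix

namespace Summit.QuantumFields.BalabanUV.T4Continuum.NE7K1LinWalkLine

open Literature.MathematicalPhysics.QuantumFieldTheory.Balaban1983to89
open Literature.MathematicalPhysics.QuantumFieldTheory.Balaban1983to89.B4Reflection242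
open Literature.MathematicalPhysics.QuantumFieldTheory.Balaban1983to89.B4BoxCov237
open Literature.MathematicalPhysics.QuantumFieldTheory.Balaban1983to89.B4Lower18
open Literature.MathematicalPhysics.QuantumFieldTheory.Balaban1983to89.Beta.BlockPoincare (avg)
open Literature.MathematicalPhysics.QuantumFieldTheory.Balaban1983to89.Beta.CombesThomasForm (lap lap_form)
open NE7K1LinSchurLineForm NE7K1LinSchurLineCoords NE7K1LinBlockCoords NE7K1LinSchurLineU1 NE7K1LinSchurLineU1Sharp
  NE7K1LinTwoRunKit NE7K1LinTwoRunBonds NE7K1LinTwoRunUpper NE7K1LinTwoRunJensen NE7K1LinHomTrial NE7K1LinTwoRunMonotone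
  NE7K1LinRunBScales NE7K1LinFineOpBilinWeight NE7K1LinWalkParametrix

variable {d : ℕ} {n L : ℕ} [NeZero L] {R' : Finset (Fin (d + 1) → ℤ)}

/-! ### §1 Run B's form dominates run A's form and the fluctuation norm, for EVERY trial -/

/-- **JENSEN FOR EVERY TRIAL**: `⟨V, P_A V⟩ ≤ ⟨(V,ψ), H_B (V,ψ)⟩` for all `V, ψ` (`P_A ⪯ P_B^{Schur}` and the Schur form is below every
trial). [folklore] -/
theorem runB_form_ge_runA (hn : 1 ≤ n) (hR' : IsBlockUnion (n * L) R') {a : ℝ} (ha : 0 < a)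
    (V : ↥(R'.image (blk L)) → ℝ) (ψ : ↥(R'.image (blk L)) × NZ d L → ℝ) :
    V ⬝ᵥ (runA n L a R').mulVec V ≤ Sum.elim V ψ ⬝ᵥ (runB (isBlockUnion_fine hR') n a).mulVec (Sum.elim V ψ) :=
  (runA_form_le_schurB_sharp hn hR' ha V).trans (schurB_form_le_trial_fluct hn hR' ha V ψ)

/-- the fine field of `(V,ψ)` minus the block values of `V` is the fine field of `(0,ψ)`. [folklore] -/
theorem coordT_sub_blockConst (hR'L : IsBlockUnion L R') (V : ↥(R'.image (blk L)) → ℝ) (ψ : ↥(R'.image (blk L)) × NZ d L → ℝ)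
    (x' : ↥R') : (coordT hR'L).mulVec (Sum.elim V ψ) x' - V (rblk L R' x') =
      (coordT hR'L).mulVec (Sum.elim (0 : ↥(R'.image (blk L)) → ℝ) ψ) x' := by
  have hsplit : Sum.elim V ψ = Sum.elim V (0 : ↥(R'.image (blk L)) × NZ d L → ℝ) + Sum.elim (0 : ↥(R'.image (blk L)) → ℝ) ψ := by
    ext c; rcases c with b | bj <;> simp
  rw [hsplit, mulVec_add, Pi.add_apply, coordT_inl hR'L V]
  ring

/-- **THE FLUCTUATION FLOOR FOR EVERY TRIAL**: `(2n²∕L^{d+1})·‖ψ‖² ≤ ⟨(V,ψ), H_B (V,ψ)⟩` for all `V` (within-block energy does not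
see `V`; block Poincaré with block means `V_b`; `‖T(0,ψ)‖² ≥ ‖ψ‖²`). [folklore] -/
theorem runB_form_ge_fluct (hn : 1 ≤ n) (hR' : IsBlockUnion (n * L) R') {a : ℝ} (ha : 0 ≤ a)
    (V : ↥(R'.image (blk L)) → ℝ) (ψ : ↥(R'.image (blk L)) × NZ d L → ℝ) :
    2 * (n : ℝ) ^ 2 / (L : ℝ) ^ (d + 1) * (ψ ⬝ᵥ ψ) ≤
      Sum.elim V ψ ⬝ᵥ (runB (isBlockUnion_fine hR') n a).mulVec (Sum.elim V ψ) := by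
  classical
  have hR'L : IsBlockUnion L R' := isBlockUnion_fine hR'
  have hnL : 1 ≤ n * L := Nat.one_le_iff_ne_zero.2 (Nat.mul_ne_zero (Nat.one_le_iff_ne_zero.1 hn) (NeZero.ne L))
  have hL0 : (0 : ℝ) < L := by exact_mod_cast (NeZero.one_le : 1 ≤ L)
  have hLpow : (0 : ℝ) < (L : ℝ) ^ (d + 1) := by positivity
  set u : ↥(R'.image (blk L)) ⊕ (↥(R'.image (blk L)) × NZ d L) → ℝ := Sum.elim V ψ with hu
  set u₀ : ↥(R'.image (blk L)) ⊕ (↥(R'.image (blk L)) × NZ d L) → ℝ := Sum.elim (0 : ↥(R'.image (blk L)) → ℝ) ψ with hu₀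
  set f := (coordT hR'L).mulVec u with hf
  set f₀ := (coordT hR'L).mulVec u₀ with hf₀
  have hE : u ⬝ᵥ (runB hR'L n a).mulVec u = ((L : ℝ) ^ (d + 1))⁻¹ * (f ⬝ᵥ (fineOpR (n * L) a 0 R').mulVec f) := by
    rw [runB, dot_congr_mulVec]
  -- (i) the bond energy is below the form
  have hbonds : (((n * L : ℕ) : ℝ)) ^ 2 * ∑ k : RBond R', (f (rtgt k) - f (rsrc k)) ^ 2 ≤
      f ⬝ᵥ (fineOpR (n * L) a 0 R').mulVec f := by
    have hb := bondEnergy_le_dirichletPart (n * L) R' f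
    have hd := dirichlet_le_fineOpR_form hnL hR' ha f
    rw [lap_form _ (adjC_symm (n * L) R')] at hd
    have h1 : ∑ x : ↥R', ∑ y : ↥R', adjC (n * L) R' x y * (f x - f y) ^ 2 =
        (((n * L : ℕ) : ℝ)) ^ 2 * ∑ x : ↥R', ∑ y : ↥R', (if y.1 ∈ nbrs x.1 then (f x - f y) ^ 2 else 0) := by
      rw [Finset.mul_sum]
      refine Finset.sum_congr rfl fun x _ => ?_
      rw [Finset.mul_sum]
      refine Finset.sum_congr rfl fun y _ => ?_
      unfold adjC
      split_ifs <;> push_cast <;> ring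
    rw [h1] at hd
    linarith
  -- (ii) block Poincaré with the block means `V_b`: the variance of `f` on a block is the norm of `f₀` there
  have hmean : ∀ b : ↥(R'.image (blk L)), avg (Finset.univ.filter fun i => rblk L R' i = b) f = V b := by
    intro b
    rw [avg, hf, blockSum_coordT hR'L u b, card_filter_rblk NeZero.one_le hR'L b]
    simp [hu]
    field_simp
  have hblocks : f₀ ⬝ᵥ f₀ ≤ (L : ℝ) ^ 2 / 2 * ∑ k : RBond R', (f (rtgt k) - f (rsrc k)) ^ 2 := by
    have h1 : f₀ ⬝ᵥ f₀ = ∑ b : ↥(R'.image (blk L)), ∑ i ∈ Finset.univ.filter (fun i => rblk L R' i = b), (f i - V b) ^ 2 := by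
      rw [dotProduct, ← Finset.sum_fiberwise_of_maps_to (s := (Finset.univ : Finset ↥R')) (t := Finset.univ)
        (g := rblk L R') (fun i _ => Finset.mem_univ _)]
      refine Finset.sum_congr rfl fun b _ => Finset.sum_congr rfl fun i hi => ?_
      rw [(Finset.mem_filter.mp hi).2.symm, hf₀, hu₀, ← coordT_sub_blockConst hR'L V ψ i]
      ring
    rw [h1]
    calc ∑ b : ↥(R'.image (blk L)), ∑ i ∈ Finset.univ.filter (fun i => rblk L R' i = b), (f i - V b) ^ 2
        ≤ ∑ b : ↥(R'.image (blk L)), (L : ℝ) ^ 2 / 2 * ∑ k ∈ Finset.univ.filter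
            (fun k : RBond R' => rblk L R' (rsrc k) = b ∧ rblk L R' (rtgt k) = b), (f (rtgt k) - f (rsrc k)) ^ 2 := by
          refine Finset.sum_le_sum fun b _ => ?_
          have h := blockPoincare_fine hR'L b f
          rw [hmean b] at h
          exact h
      _ = (L : ℝ) ^ 2 / 2 * ∑ b : ↥(R'.image (blk L)), ∑ k ∈ Finset.univ.filter
            (fun k : RBond R' => rblk L R' (rsrc k) = b ∧ rblk L R' (rtgt k) = b), (f (rtgt k) - f (rsrc k)) ^ 2 := by
          rw [Finset.mul_sum]
      _ ≤ (L : ℝ) ^ 2 / 2 * ∑ k : RBond R', (f (rtgt k) - f (rsrc k)) ^ 2 :=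
          mul_le_mul_of_nonneg_left (sum_blockBonds_le _ fun k => sq_nonneg _) (by positivity)
  -- (iii) `‖ψ‖² ≤ ‖f₀‖²`
  have hψ : ψ ⬝ᵥ ψ ≤ f₀ ⬝ᵥ f₀ := by
    have h := dot_le_coordT hR'L u₀
    rw [one_mul] at h
    have : u₀ ⬝ᵥ u₀ = ψ ⬝ᵥ ψ := by rw [hu₀, sumElim_dotProduct_sumElim, zero_dotProduct, zero_add]
    rw [← this]; exact h
  -- assemble
  rw [hE, div_mul_eq_mul_div, div_le_iff₀ hLpow, mul_comm (((L : ℝ) ^ (d + 1))⁻¹ * _) _, ← mul_assoc,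
    mul_inv_cancel₀ hLpow.ne', one_mul]
  have hcast : (((n * L : ℕ) : ℝ)) ^ 2 = (n : ℝ) ^ 2 * (L : ℝ) ^ 2 := by push_cast; ring
  rw [hcast] at hbonds
  have hL2 : (0 : ℝ) < (L : ℝ) ^ 2 := by positivity
  have hsum0 : 0 ≤ ∑ k : RBond R', (f (rtgt k) - f (rsrc k)) ^ 2 := Finset.sum_nonneg fun k _ => sq_nonneg _
  have h4 : (n : ℝ) ^ 2 * (L : ℝ) ^ 2 * (f₀ ⬝ᵥ f₀) ≤ (n : ℝ) ^ 2 * (L : ℝ) ^ 2 * ((L : ℝ) ^ 2 / 2 * ∑ k : RBond R', (f (rtgt k) - f (rsrc k)) ^ 2) :=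
    mul_le_mul_of_nonneg_left hblocks (by positivity)
  nlinarith [hbonds, hψ, h4, sq_nonneg (n : ℝ)]

/-! ### §2 The rescaled extended operator, its form and its coercivity -/

/-- **THE ψ-RESCALED EXTENDED TWO-CUTOFF OPERATOR** `𝒫♮(s) = extOpR P_A H♮₁₁ H♮₁₂ H♮₂₁ H♮₂₂ s`, `H♮ = runBμ (1∕n) = S_{1∕n}H_BS_{1∕n}`.
[folklore] -/
def extLine (hR'L : IsBlockUnion L R') (n : ℕ) (a s : ℝ) :
    Matrix (↥(R'.image (blk L)) ⊕ (↥(R'.image (blk L)) × NZ d L)) (↥(R'.image (blk L)) ⊕ (↥(R'.image (blk L)) × NZ d L)) ℝ :=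
  extOpR (runA n L a R') (runBμ hR'L n a (1 / (n : ℝ))).toBlocks₁₁ (runBμ hR'L n a (1 / (n : ℝ))).toBlocks₁₂
    (runBμ hR'L n a (1 / (n : ℝ))).toBlocks₂₁ (runBμ hR'L n a (1 / (n : ℝ))).toBlocks₂₂ s

/-- the form of `H♮ = S_μ H_B S_μ` at `u` is the form of `H_B` at `S_μ u`. [folklore] -/
theorem runBμ_form (hR'L : IsBlockUnion L R') (n : ℕ) (a μ : ℝ)
    (u : ↥(R'.image (blk L)) ⊕ (↥(R'.image (blk L)) × NZ d L) → ℝ) :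
    u ⬝ᵥ (runBμ hR'L n a μ).mulVec u =
      (scaleR _ _ μ).mulVec u ⬝ᵥ (runB hR'L n a).mulVec ((scaleR _ _ μ).mulVec u) := by
  rw [runBμ_eq, ← mulVec_mulVec, ← mulVec_mulVec, dotProduct_mulVec, ← mulVec_transpose, scaleR_transpose]

/-- **THE FORM OF `𝒫♮(s)`**: `⟨w, 𝒫♮(s)w⟩ = (1−s)⟨a, P_A a⟩ + ⟨(√s·a, ψ∕n), H_B(√s·a, ψ∕n)⟩` (`0 ≤ s`). [folklore] -/
theorem extLine_form (hR'L : IsBlockUnion L R') (n : ℕ) (a : ℝ) {s : ℝ} (hs : 0 ≤ s)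
    (w : ↥(R'.image (blk L)) ⊕ (↥(R'.image (blk L)) × NZ d L) → ℝ) :
    w ⬝ᵥ (extLine hR'L n a s).mulVec w =
      (1 - s) * ((w ∘ Sum.inl) ⬝ᵥ (runA n L a R').mulVec (w ∘ Sum.inl)) +
        Sum.elim (Real.sqrt s • (w ∘ Sum.inl)) ((1 / (n : ℝ)) • (w ∘ Sum.inr)) ⬝ᵥ
          (runB hR'L n a).mulVec (Sum.elim (Real.sqrt s • (w ∘ Sum.inl)) ((1 / (n : ℝ)) • (w ∘ Sum.inr))) := by
  rw [extLine, form₂_extOpR _ _ _ _ _ hs, fromBlocks_toBlocks, runBμ_form]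
  congr 2 <;> simp only [scaleR_mulVec, uvecR, Sum.elim_comp_inl, Sum.elim_comp_inr]

/-- **COERCIVITY OF `𝒫♮(s)` WITH A CONSTANT FREE OF THE MESH AND OF `s`**: for `a > 0`, `n ≥ 1`, `R′` a union of `nL`-blocks and every
`s ∈ [0,1]`, `min(min(2,a)∕2, L^{−(d+1)})·‖w‖² ≤ ⟨w, 𝒫♮(s)w⟩` (run A's floor `min(2,a)` on the coarse part by Jensen for every trial,
the fluctuation floor `2n²∕L^{d+1}` against the rescaling `1∕n²`). [folklore] -/
theorem extLine_coercive (hn : 1 ≤ n) (hR' : IsBlockUnion (n * L) R') {a : ℝ} (ha : 0 < a) {s : ℝ} (hs0 : 0 ≤ s) (hs1 : s ≤ 1)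
    (w : ↥(R'.image (blk L)) ⊕ (↥(R'.image (blk L)) × NZ d L) → ℝ) :
    min (min 2 a / 2) (1 / (L : ℝ) ^ (d + 1)) * (w ⬝ᵥ w) ≤ w ⬝ᵥ (extLine (isBlockUnion_fine hR') n a s).mulVec w := by
  have hR'L : IsBlockUnion L R' := isBlockUnion_fine hR'
  have hn0 : (0 : ℝ) < n := by exact_mod_cast hn
  have hLpow : (0 : ℝ) < (L : ℝ) ^ (d + 1) := pow_pos (by exact_mod_cast (NeZero.one_le : 1 ≤ L)) _
  rw [extLine_form hR'L n a hs0 w, dot_self_sum]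
  set av := w ∘ Sum.inl with hav
  set ψ := w ∘ Sum.inr with hψ
  have hss : Real.sqrt s * Real.sqrt s = s := Real.mul_self_sqrt hs0
  -- run A's floor on the coarse part, twice
  have hA : min 2 a * (av ⬝ᵥ av) ≤ av ⬝ᵥ (runA n L a R').mulVec av :=
    lower18_zero hn ha.le (isBlockUnion_coarse NeZero.one_le hR') av
  have hJ := runB_form_ge_runA hn hR' ha (Real.sqrt s • av) ((1 / (n : ℝ)) • ψ)
  have hA' : min 2 a * ((Real.sqrt s • av) ⬝ᵥ (Real.sqrt s • av)) ≤ (Real.sqrt s • av) ⬝ᵥ (runA n L a R').mulVec (Real.sqrt s • av) :=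
    lower18_zero hn ha.le (isBlockUnion_coarse NeZero.one_le hR') (Real.sqrt s • av)
  have hsq : (Real.sqrt s • av) ⬝ᵥ (Real.sqrt s • av) = s * (av ⬝ᵥ av) := by
    rw [smul_dotProduct, dotProduct_smul, smul_eq_mul, smul_eq_mul, ← mul_assoc, hss]
  -- the fluctuation floor
  have hF := runB_form_ge_fluct hn hR' ha.le (Real.sqrt s • av) ((1 / (n : ℝ)) • ψ)
  have hsq' : ((1 / (n : ℝ)) • ψ) ⬝ᵥ ((1 / (n : ℝ)) • ψ) = (1 / (n : ℝ)) ^ 2 * (ψ ⬝ᵥ ψ) := by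
    rw [smul_dotProduct, dotProduct_smul, smul_eq_mul, smul_eq_mul]; ring
  rw [hsq'] at hF
  have hF' : 2 / (L : ℝ) ^ (d + 1) * (ψ ⬝ᵥ ψ) ≤ Sum.elim (Real.sqrt s • av) ((1 / (n : ℝ)) • ψ) ⬝ᵥ
      (runB hR'L n a).mulVec (Sum.elim (Real.sqrt s • av) ((1 / (n : ℝ)) • ψ)) := by
    refine le_trans (le_of_eq ?_) hF
    field_simp
  have hav0 : 0 ≤ av ⬝ᵥ av := Finset.sum_nonneg fun i _ => mul_self_nonneg _
  have hψ0 : 0 ≤ ψ ⬝ᵥ ψ := Finset.sum_nonneg fun i _ => mul_self_nonneg _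
  have hmin0 : 0 < min 2 a := lt_min two_pos ha
  have hm1 : min (min 2 a / 2) (1 / (L : ℝ) ^ (d + 1)) ≤ min 2 a / 2 := min_le_left _ _
  have hm2 : min (min 2 a / 2) (1 / (L : ℝ) ^ (d + 1)) ≤ 1 / (L : ℝ) ^ (d + 1) := min_le_right _ _
  rw [hsq] at hA'
  -- ⟨u,H_Bu⟩ ≥ ½(s·γ₀‖a‖²) + ½(2∕L^{d+1})‖ψ‖²
  have hH : s * (min 2 a) * (av ⬝ᵥ av) / 2 + (1 / (L : ℝ) ^ (d + 1)) * (ψ ⬝ᵥ ψ) ≤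
      Sum.elim (Real.sqrt s • av) ((1 / (n : ℝ)) • ψ) ⬝ᵥ (runB hR'L n a).mulVec (Sum.elim (Real.sqrt s • av) ((1 / (n : ℝ)) • ψ)) := by
    have e : (1 / (L : ℝ) ^ (d + 1)) * (ψ ⬝ᵥ ψ) = (2 / (L : ℝ) ^ (d + 1) * (ψ ⬝ᵥ ψ)) / 2 := by ring
    rw [e]
    linarith [hA'.trans hJ]
  calc min (min 2 a / 2) (1 / (L : ℝ) ^ (d + 1)) * (av ⬝ᵥ av + ψ ⬝ᵥ ψ)
      ≤ min 2 a / 2 * (av ⬝ᵥ av) + (1 / (L : ℝ) ^ (d + 1)) * (ψ ⬝ᵥ ψ) := by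
        rw [mul_add]; exact add_le_add (mul_le_mul_of_nonneg_right hm1 hav0) (mul_le_mul_of_nonneg_right hm2 hψ0)
    _ ≤ (1 - s) * (av ⬝ᵥ (runA n L a R').mulVec av) +
          Sum.elim (Real.sqrt s • av) ((1 / (n : ℝ)) • ψ) ⬝ᵥ
            (runB hR'L n a).mulVec (Sum.elim (Real.sqrt s • av) ((1 / (n : ℝ)) • ψ)) := by
        have h1 : (1 - s) * (min 2 a * (av ⬝ᵥ av)) ≤ (1 - s) * (av ⬝ᵥ (runA n L a R').mulVec av) :=
          mul_le_mul_of_nonneg_left hA (by linarith)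
        nlinarith [hH, h1, mul_nonneg hmin0.le hav0]

/-! ### §3 The coarse inverse block of `𝒫♮(s)` is the line's propagator -/

/-- the fine block of `H♮` is coercive (floor `2∕L^{d+1}`), hence invertible. [folklore] -/
theorem isUnit_det_fineBlock (hn : 1 ≤ n) (hR' : IsBlockUnion (n * L) R') {a : ℝ} (ha : 0 ≤ a) :
    IsUnit ((runBμ (isBlockUnion_fine hR') n a (1 / (n : ℝ))).toBlocks₂₂).det := by
  have hR'L : IsBlockUnion L R' := isBlockUnion_fine hR'
  have hn0 : (0 : ℝ) < n := by exact_mod_cast hn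
  have hLpow : (0 : ℝ) < (L : ℝ) ^ (d + 1) := pow_pos (by exact_mod_cast (NeZero.one_le : 1 ≤ L)) _
  refine isUnit_det_of_coercive _ (σ := 2 / (L : ℝ) ^ (d + 1)) (by positivity) fun φ => ?_
  have hform : φ ⬝ᵥ ((runBμ hR'L n a (1 / (n : ℝ))).toBlocks₂₂).mulVec φ =
      Sum.elim (0 : ↥(R'.image (blk L)) → ℝ) φ ⬝ᵥ (runBμ hR'L n a (1 / (n : ℝ))).mulVec (Sum.elim (0 : ↥(R'.image (blk L)) → ℝ) φ) := by
    conv_rhs => rw [← fromBlocks_toBlocks (runBμ hR'L n a (1 / (n : ℝ)))]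
    simp only [fromBlocks_mulVec, Sum.elim_comp_inl, Sum.elim_comp_inr, mulVec_zero, zero_add, sumElim_dotProduct_sumElim,
      zero_dotProduct]
  rw [hform, runBμ_form]
  simp only [scaleR_mulVec, Sum.elim_comp_inl, Sum.elim_comp_inr]
  have hF := runB_form_ge_fluct hn hR' ha (0 : ↥(R'.image (blk L)) → ℝ) ((1 / (n : ℝ)) • φ)
  have hsq' : ((1 / (n : ℝ)) • φ) ⬝ᵥ ((1 / (n : ℝ)) • φ) = (1 / (n : ℝ)) ^ 2 * (φ ⬝ᵥ φ) := by
    rw [smul_dotProduct, dotProduct_smul, smul_eq_mul, smul_eq_mul]; ring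
  rw [hsq'] at hF
  refine le_trans (le_of_eq ?_) hF
  field_simp

/-- **THE COARSE INVERSE BLOCK OF `𝒫♮(s)` IS THE LINE'S PROPAGATOR**: `(𝒫♮(s))⁻¹(inl x, inl y) = (twoCutoffLine s)⁻¹(x,y)` for every
`s ∈ [0,1]` (`a > 0`): the random walk may be run on `𝒫♮(s)` and read off on the coarse block. [folklore] -/
theorem extLine_inv_inl_inl (hn : 1 ≤ n) (hR' : IsBlockUnion (n * L) R') {a : ℝ} (ha : 0 < a) {s : ℝ} (hs0 : 0 ≤ s)
    (x y : ↥(R'.image (blk L))) :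
    (extLine (isBlockUnion_fine hR') n a s)⁻¹ (Sum.inl x) (Sum.inl y) = (twoCutoffLine (isBlockUnion_fine hR') n a s)⁻¹ x y := by
  have hR'L : IsBlockUnion L R' := isBlockUnion_fine hR'
  have hn0 : (0 : ℝ) < n := by exact_mod_cast hn
  have hμ : (1 / (n : ℝ)) ≠ 0 := by positivity
  have hline := lineOpR_runBμ hR'L n a hμ s
  have hS : IsUnit (lineOpR (runA n L a R') (runBμ hR'L n a (1 / (n : ℝ))).toBlocks₁₁ (runBμ hR'L n a (1 / (n : ℝ))).toBlocks₁₂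
      (runBμ hR'L n a (1 / (n : ℝ))).toBlocks₂₁ (runBμ hR'L n a (1 / (n : ℝ))).toBlocks₂₂ s).det := by
    rw [hline]
    exact isUnit_det_of_coercive _ (lt_min two_pos ha) (twoCutoffLine_coercive_sharp hn hR' ha hs0)
  rw [extLine, inv_extOpR_inl_inl _ _ _ _ _ hs0 (isUnit_det_fineBlock hn hR' ha.le) hS, hline]

/-! ### §4 The cut-off commutator factors through the fine lattice -/

/-- the coordinate index type `coarse sites ⊕ (coarse site × non-zero offset)`. [folklore] -/
abbrev Idx (L : ℕ) [NeZero L] (R' : Finset (Fin (d + 1) → ℤ)) : Type := ↥(R'.image (blk L)) ⊕ (↥(R'.image (blk L)) × NZ d L)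

/-- **`T_μ` INTERTWINES THE CUT-OFFS**: `T_μ·diag(λ∘site) = diag(λ∘blk)·T_μ` — a cut-off on the coarse sites, read on the coordinates
through `site` and on the fine points through `blk`, commutes past the block-local coordinate matrix (`coordTμ_compat`). [folklore] -/
theorem coordTμ_mul_diagonal (hR'L : IsBlockUnion L R') (μ : ℝ) (lam : ↥(R'.image (blk L)) → ℝ) :
    coordTμ hR'L μ * diagonal (fun c : Idx L R' => lam (site c)) = diagonal (fun x' => lam (rblk L R' x')) * coordTμ hR'L μ := by
  ext x' c
  rw [mul_diagonal, diagonal_mul]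
  by_cases h : coordTμ hR'L μ x' c = 0
  · rw [h, zero_mul, mul_zero]
  · rw [coordTμ_compat hR'L μ x' c h, mul_comm]

/-- the `s`-scaling `S_s = diag(√s on the coarse labels, 1 on the fluctuation labels)`. [folklore] -/
def sScale (L : ℕ) [NeZero L] (R' : Finset (Fin (d + 1) → ℤ)) (s : ℝ) : Matrix (Idx L R') (Idx L R') ℝ :=
  diagonal (Sum.elim (fun _ => Real.sqrt s) (fun _ => 1))

/-- `S_s` in block form. [folklore] -/
theorem sScale_eq_fromBlocks (s : ℝ) :
    sScale L R' s = fromBlocks (Real.sqrt s • (1 : Matrix ↥(R'.image (blk L)) ↥(R'.image (blk L)) ℝ)) 0 0 1 := by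
  ext c c'
  rcases c with b | bj <;> rcases c' with b' | bj'
  · simp only [sScale, diagonal_apply, Sum.elim_inl, fromBlocks_apply₁₁, Matrix.smul_apply, Matrix.one_apply, smul_eq_mul,
      mul_ite, mul_one, mul_zero, Sum.inl.injEq]
  · simp [sScale]
  · simp [sScale]
  · simp only [sScale, diagonal_apply, Sum.elim_inr, fromBlocks_apply₂₂, Matrix.one_apply, Sum.inr.injEq]

/-- `S_s·H·S_s` has blocks `(sH₁₁, √sH₁₂, √sH₂₁, H₂₂)` (`0 ≤ s`). [folklore] -/
theorem sScale_mul_mul_sScale {s : ℝ} (hs : 0 ≤ s) (H : Matrix (Idx L R') (Idx L R') ℝ) :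
    sScale L R' s * H * sScale L R' s =
      fromBlocks (s • H.toBlocks₁₁) (Real.sqrt s • H.toBlocks₁₂) (Real.sqrt s • H.toBlocks₂₁) H.toBlocks₂₂ := by
  have hss : Real.sqrt s * Real.sqrt s = s := Real.mul_self_sqrt hs
  conv_lhs => rw [sScale_eq_fromBlocks, ← fromBlocks_toBlocks H]
  simp only [fromBlocks_multiply, Matrix.one_mul, Matrix.mul_one, Matrix.zero_mul, Matrix.mul_zero, add_zero, zero_add,
    Matrix.smul_mul, Matrix.mul_smul, smul_smul, hss]

/-- the rescaled coordinates with the `s`-scaling: `T_μS_s`, `μ = 1∕n`. [folklore] -/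
def coordTs (hR'L : IsBlockUnion L R') (n : ℕ) (s : ℝ) : Matrix ↥R' (Idx L R') ℝ :=
  coordTμ hR'L (1 / (n : ℝ)) * sScale L R' s

/-- **`𝒫♮(s)` AS A SUM OF SQUARES THROUGH THE FINE LATTICE**:
`𝒫♮(s) = (1−s)·(P_A ⊕ 0) + L^{−(d+1)}·(T_μS_s)ᵀ·P_f·(T_μS_s)`, `μ = 1∕n`, `P_f = fineOpR (nL) a 0 R′` (`0 ≤ s`). [folklore] -/
theorem extLine_eq (hR'L : IsBlockUnion L R') (n : ℕ) (a : ℝ) {s : ℝ} (hs : 0 ≤ s) :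
    extLine hR'L n a s = (1 - s) • (fromBlocks (runA n L a R') 0 0 0 : Matrix (Idx L R') (Idx L R') ℝ) +
      (((L : ℝ) ^ (d + 1))⁻¹) • ((coordTs hR'L n s)ᵀ * fineOpR (n * L) a 0 R' * coordTs hR'L n s) := by
  have h1 : (coordTs hR'L n s)ᵀ * fineOpR (n * L) a 0 R' * coordTs hR'L n s =
      sScale L R' s * ((coordTμ hR'L (1 / (n : ℝ)))ᵀ * fineOpR (n * L) a 0 R' * coordTμ hR'L (1 / (n : ℝ))) * sScale L R' s := by
    rw [coordTs, transpose_mul, show (sScale L R' s)ᵀ = sScale L R' s from diagonal_transpose _]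
    simp only [Matrix.mul_assoc]
  have hLpow : ((L : ℝ) ^ (d + 1)) ≠ 0 := pow_ne_zero _ (by exact_mod_cast (NeZero.ne L))
  have h2 : (coordTμ hR'L (1 / (n : ℝ)))ᵀ * fineOpR (n * L) a 0 R' * coordTμ hR'L (1 / (n : ℝ)) =
      ((L : ℝ) ^ (d + 1)) • runBμ hR'L n a (1 / (n : ℝ)) := by
    rw [runBμ, smul_smul, mul_inv_cancel₀ hLpow, one_smul]
  rw [h1, h2, Matrix.mul_smul, Matrix.smul_mul, smul_smul, inv_mul_cancel₀ hLpow, one_smul, sScale_mul_mul_sScale hs, extLine,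
    extOpR, fromBlocks_smul, fromBlocks_add]
  simp

/-- **THE CUT-OFF COMMUTATOR OF `𝒫♮(s)` FACTORS THROUGH THE FINE LATTICE**: for a coarse cut-off `λ` read on the coordinates through
`site`, `[diag(λ∘site), 𝒫♮(s)] = (1−s)·([diag λ, P_A] ⊕ 0) + L^{−(d+1)}·(T_μS_s)ᵀ·[diag(λ∘blk), P_f]·(T_μS_s)` (`0 ≤ s`) — the coarse
block is file 4's Laplacian commutator, the rest is the FINE operator's commutator with the block-constant cut-off, sandwiched by the
(rescaled) coordinates. [folklore] -/
theorem comm_extLine (hR'L : IsBlockUnion L R') (n : ℕ) (a : ℝ) {s : ℝ} (hs : 0 ≤ s) (lam : ↥(R'.image (blk L)) → ℝ) :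
    NE7K1LinWalkParametrix.comm (fun c : Idx L R' => lam (site c)) (extLine hR'L n a s) =
      (1 - s) • (fromBlocks (NE7K1LinWalkParametrix.comm lam (runA n L a R')) 0 0 0 : Matrix (Idx L R') (Idx L R') ℝ) +
        (((L : ℝ) ^ (d + 1))⁻¹) • ((coordTs hR'L n s)ᵀ *
          NE7K1LinWalkParametrix.comm (fun x' => lam (rblk L R' x')) (fineOpR (n * L) a 0 R') * coordTs hR'L n s) := by
  set Tm := coordTs hR'L n s with hTm
  set Λ : Idx L R' → ℝ := fun c => lam (site c) with hΛ
  set lamf : ↥R' → ℝ := fun x' => lam (rblk L R' x') with hlamf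
  set Pf := fineOpR (n * L) a 0 R' with hPf
  -- the intertwining `Tm·diag Λ = diag(λ∘blk)·Tm` (diagonals commute past `S_s`)
  have hSd : sScale L R' s * diagonal Λ = diagonal Λ * sScale L R' s := by
    rw [sScale, diagonal_mul_diagonal, diagonal_mul_diagonal]
    congr 1; funext i; exact mul_comm _ _
  have hint : Tm * diagonal Λ = diagonal lamf * Tm := by
    rw [hTm, coordTs, Matrix.mul_assoc, hSd, ← Matrix.mul_assoc, coordTμ_mul_diagonal, Matrix.mul_assoc]
  have hint' : diagonal Λ * Tmᵀ = Tmᵀ * diagonal lamf := by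
    have := congrArg transpose hint
    rw [transpose_mul, transpose_mul, diagonal_transpose, diagonal_transpose] at this
    exact this
  -- the coarse block
  have hcoarse : diagonal Λ * (fromBlocks (runA n L a R') 0 0 0 : Matrix (Idx L R') (Idx L R') ℝ) -
      fromBlocks (runA n L a R') 0 0 0 * diagonal Λ = fromBlocks (NE7K1LinWalkParametrix.comm lam (runA n L a R')) 0 0 0 := by
    have hD : diagonal Λ = fromBlocks (diagonal lam) 0 0 (diagonal fun bj : ↥(R'.image (blk L)) × NZ d L => lam bj.1) := by
      rw [fromBlocks_diagonal]; congr 1; ext c; rcases c with b | bj <;> rfl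
    rw [hD, fromBlocks_multiply, fromBlocks_multiply, NE7K1LinWalkParametrix.comm]
    ext i j
    rcases i with i | i <;> rcases j with j | j <;> simp
  -- the fine part
  have hfine : diagonal Λ * (Tmᵀ * Pf * Tm) - Tmᵀ * Pf * Tm * diagonal Λ = Tmᵀ * NE7K1LinWalkParametrix.comm lamf Pf * Tm := by
    rw [NE7K1LinWalkParametrix.comm, Matrix.mul_sub, Matrix.sub_mul, ← Matrix.mul_assoc, ← Matrix.mul_assoc, hint',
      Matrix.mul_assoc (Tmᵀ * Pf) Tm, hint]
    simp only [Matrix.mul_assoc]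
  rw [NE7K1LinWalkParametrix.comm, extLine_eq hR'L n a hs, ← hTm, ← hPf, Matrix.mul_add, Matrix.add_mul, Matrix.mul_smul,
    Matrix.smul_mul, Matrix.mul_smul, Matrix.smul_mul, ← hfine, ← hcoarse, smul_sub, smul_sub]
  abel

end Summit.QuantumFields.BalabanUV.T4Continuum.NE7K1LinWalkLine

end
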